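import Literature.MathematicalPhysics.QuantumFieldTheory.Balaban1983to89.B5Leaf235Torus

/-!
# B4 «Theorem (Proposition 2.1 of [1])», the clauses (1.10) — `|(G_k f)(x)|, |(D^η_μG_k f)(x)| ≤ c₀e^{−δ₀dist(x, supp f)}‖f‖_∞`
# — PROVED at `A = 0` ON THE TORUS for Bałaban's concrete scalar tower, every volume and every scale `1 ≤ k ≤ K`, by the
# print's box route (2.34) + Lemma 2.4 «with □ replaced by the whole torus»

statement-level skeleton of published theorems with citation tags; proofs where landed; nothing here is a claim about the
Yang–Mills mass gap

B4 = T. Bałaban, *Regularity and decay of lattice Green's functions*, Commun. Math. Phys. **89** (1983) 571–597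
[cite: Balaban1983RegularityDecay] (journal page = PDF page + 570; held `paper:balaban1983-cmp89-regularity-decay`, p0002, p0003,
p0012 materialised and read by this seat); B5 = T. Bałaban, *Propagators and renormalization transformations for lattice gauge
theories. I*, Commun. Math. Phys. **95** (1984) 17–40 [cite: Balaban1984PropagatorsI] (p0023 read); B1 = *(Higgs)₂,₃ quantum fields
in a finite volume I*, Commun. Math. Phys. **85** (1982) 603–636 [cite: Balaban1982Higgs1].  Cell `lit-balaban` (Phase-2 proof seat
p38 gen 4), programme «[2]'s Theorem on the torus at A = 0» = the input `hThm` of `B5Prop12Chain.prop12_of_B4_walk` for the B5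
Prop. 1.2 census (HOME `ROWS-B5.md` row B5.Prop1.2; owner r02): file F2 (announced as `B4Eq234TorusKernels`/`B4Thm110ZeroTorus`,
merged).  Siblings: p37 g5's `B5Display135Torus` (p252772: the same (2.34) kernel identity in B5's normalisation, for `G_k` and
`G_k∂*` — this file re-derives it in B4 vocabulary with the LEFT derivative and adds the estimates) and the box lineage
`B4Thm110ZeroBox`/`B4Thm110ZeroBoxDeriv` (pv17: the same clauses for Neumann boxes).

## WHAT IS PRINTED (verbatim; `≦` of the print written `≤`)

* p. 573 [PDF 3]: «**Theorem** (Proposition 2.1 of [1]). For α < 1 there exist positive constants δ₀, c₀, R₀ independent of A, k, Ω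
  and depending on d, M only, c₀ on α also, such that for e sufficiently small and for an arbitrary function f : Ω → R^N, we have
  … Similarly |(D^η_{A,μ}G_k(Ω, A)f)(x)|, |(G_k(Ω, A)(x)| ≤ c₀ exp(−δ₀ dist(x, supp f))‖f‖_∞ (1.10) for x ∈ Ω, dist(x, Ω^c) ≥ R₀.
  … For some simple sets Ω, e.g. for rectangular parallelepipeds, the inequalities hold without any restrictions on the points
  x, x′, i.e. for all x, x′ ∈ Ω.» ⟦sic: «(G_k(Ω, A)(x)» for `(G_k(Ω, A)f)(x)`⟧
* p. 572 [PDF 2]: «Another common case is to consider operators on subsets of a torus T_η which we identify with a rectangular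
  parallelepiped in ηZ^d with periodic conditions.»
* p. 582 [PDF 12]: «This proof is based on renormalization group equations (2.43) of [1] rescaled to the η-lattice:
  G_k(□) = C^{(0),η}(□) + Σ_{j=1}^{k−1} a_j²(L^jη)^{−4}G^η_j(□)Q_j^*C^{(j),L^jη}(□)Q_jG^η_j(□). (2.34)» and Lemma 2.4 (2.35)–(2.37)
  (quoted in `B4Lemma24TorusHolder`); (2.38)–(2.39): each term «rescaled to the L^{−j}-lattice» carries a power of `L^jη`, and
  «(2.39) … ≤ O(1) Σ_{j=0}^{k−1}(L^jη)^{1−α}‖f‖_∞»; p. 584 [PDF 14]: «This part of the argument is valid for an arbitrary rectangular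
  parallelepiped □ built of unit blocks, so the inequalities are valid for all such sets.»
* B5 p. 39 [PDF 23]: «We use Lemma 2.4 of that paper and the equality (2.34) with □ replaced by the whole torus.»

## WHAT THIS FILE CERTIFIES (kernel-checked, zero `sorry`, no hypotheses in the final theorem)

For Bałaban's CONCRETE scalar torus tower `B1RG242Torus.tower P a msq` (U = 1; levels `T^{(j)} = Site P j`, `G^ε_k = (tower …).G k`
= B4's `G_k(T_ε, 0)` at `k = K` with `η = ε = L^{−K}`, B1 (2.20)/(2.43)):
* §1 (2.34) AT KERNEL LEVEL (`B1RG242Torus.display243` read entrywise through the dictionary of `B5Display136Torus`):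
  `term_eq_rescaled` (`term_j = a_j²(L^jε)²·G_j^{resc}Q_j^*C^{(j)}Q_jG_j^{resc}`), `QkGrs_apply` (`(Q_jG_j^{resc})(y′,x′) =
  L^{−jd}(G_j^{resc}Q_j^*)(x′,y′)`), **`G_apply_eq`** (`G^ε_k(x,x′) = ε²G_0^{unit}(x,x′) + Σ_j a_j²(L^jε)² Σ_{y,y′}(G_j^{resc}Q_j^*)(x,y)
  C^{(j)}(y,y′)(Q_jG_j^{resc})(y′,x′)`), `derivGrsQks_apply` (`∂^εG_j^{resc}Q_j^* = (L^jε)^{−1}K1_j`), **`derivG_apply_eq`**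
  (`(∂^ε_μG^ε_k)(x,x′) = ε(∂¹_μG_0^{unit})(x,x′) + Σ_j a_j²(L^jε) Σ K1_j(μ;x,y)C^{(j)}(y,y′)(Q_jG_j^{resc})(y′,x′)` — one power of `L^jε`
  per term, B4 (2.38)).
* §2 `conv_bound` (the `y, y′` convolution of one term: three kernels decaying at rate `δ` on `T^{(j)}` give
  `C₁C₂C₃K_d(δ/2)²e^{−(δ/2)|u−u′|}`, by `B5Ineq137.conv_two_mid` + `B5Ineq137Torus.rowSum_T_le`), `block_row_sum` (the `x′`-sum against a
  source `f`, `|f| ≤ F`, vanishing within fine distance `D` of `x`: `Σ_{x′}L^{−jd}e^{−θ|proj x−proj x′|}|f(x′)| ≤ Fe^{θ}K_d(θ/2)e^{−(θ/2)D/L^j}`),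
  `fine_row_sum` (the `j = 0` analogue).
* §3 at one volume with the kernel inputs as hypotheses (`KerBounds`: (2.35) both quantities, (2.37), in the block distance):
  `term_row_bound`, **`value_row_bound`** and **`deriv_row_bound`** — `|(G^ε_kf)(x)|`, `|(∂^ε_μG^ε_kf)(x)| ≤ c·e^{−min(δ₀/2,δ/4)·εD}·F` with
  explicit `c` (`cTerm`, `Σ_{1≤j<k}L^jε ≤ 1/(L−1)` for `k ≤ K`).
* §4 `T_proj_le_dXU_add_one`; **`kerBounds_torus`** — the inputs HOLD for the tower, one pair `C, δ` for every volume with `P.d = d`,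
  `P.L = L` and every level under the mass cap (`B4Ineq116Torus.GQ_decay_torus`, `cov116_torus`, `B5Leaf235Torus.K13_decay_torus`); and
  **`thm110_zero_torus`** — **(1.10) ON THE TORUS, BOTH CLAUSES, HYPOTHESIS-FREE AND UNIFORM**: for `d ≥ 1`, odd `L > 1`, `a > 0`,
  `m² ≥ 0` there are `δ₀, c₀ > 0` (functions of `d, L, a, m²`) with `|(G^ε_kf)(x)| ≤ c₀e^{−δ₀εD}F` and `|(∂^ε_μG^ε_kf)(x)| ≤ c₀e^{−δ₀εD}F`
  for EVERY volume `(m, K)`, level `1 ≤ k ≤ K`, site `x`, direction `μ`, and every `f` with `|f| ≤ F` vanishing within fine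
  sup-distance `D ≥ 0` of `x` — in particular `εD = dist_η(x, supp f)`.

## DICTIONARY / HONEST SCOPE

(i) `A = 0`, `U ≡ 1`, one component; `Ω = Ω₀ =` the whole torus (the periodic parallelepiped of p. 572: the branch «for rectangular
parallelepipeds … for all x»; no `R₀`); the torus sizes are the tower's `2L^{m+K−j}` per direction.  (ii) `η = ε = L^{−K}`; at a
level `k < K` the operator `G^ε_k` is B4's `G_k` of a coarser `η`, covered anyway.  (iii) Distances: sup torus metric of
`B5Ineq137Torus` in fine units times `ε` (the print's Euclidean `dist` ≥ sup-dist, so the printed exponent follows with `δ₀/√d`);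
`‖f‖_∞ ↦` any `F ≥ |f|`; `dist(x, supp f) ↦ εD` for any `0 ≤ D ≤ |x − z|_{T^{(0)}}` on `supp f`.  (iv) Mass: the tower carries `m² ≥ 0`
(B4 (1.6)); constants depend on `m²` (fixed for the family, as in the print); the lineage's mass cap holds automatically at
`k ≤ K` since `(L^kε)² ≤ 1`.  (v) Constants existential (b04's contour shift, Sect.-5 rates), no numerical values; `δ₀ =
min(dK0/2, δ/4)`.  (vi) ROUTE = the print's pp. 582–584 for boxes, carried out on the torus; it is NOT the general random-walk proof
of Sect. 2 for unions of big blocks (not needed by B5).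

## NOT-CERTIFIED

The Hölder clause (1.9) and the `B4.EtaSetting` torus family / `ThmDepPrinted` by name (sequel F3 `B4Thm19ZeroTorus`, on top of this
file and of `B4Lemma24TorusScales`); (1.11)–(1.12) (`δG = 0` on the torus, `Ω = Ω₀`); background fields; Neumann boxes (pv17).
-/

namespace Literature.MathematicalPhysics.QuantumFieldTheory.Balaban1983to89

namespace B4Thm110ZeroTorus

open Matrix B1RG242Torus B5Display136Torus B5Leaf237C0Torus B4Ineq115Torus B5Ineq137Torus B4Ineq116Torus

noncomputable section

/-! ## §1 (2.34) on the torus at kernel level: the entries of `G^ε_k` and `∂^ε_μG^ε_k` through the rescaled operators -/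

section Algebra

variable (P : Params)

/-- The `j`-th term of (2.34) through the operators rescaled to the level-`j` unit lattice:
`a_j²(L^jε)^{−4}·G^ε_jQ_j^*C^{(j),L^jε}Q_jG^ε_j = a_j²(L^jε)²·G_j^{resc}Q_j^*C^{(j)}Q_jG_j^{resc}` (`G^ε_j = (L^jε)²G_j^{resc}`,
`C^{(j),L^jε} = (L^jε)²C^{(j)}`: `B5Display136Torus.G_eq_smul_Grs`, `C_eq_smul_Crs`). [cite: Balaban1983RegularityDecay, (2.34)
p.582; Balaban1982Higgs1, (2.43) p.612, (2.30)–(2.31) p.611] -/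
theorem term_eq_rescaled {a msq : ℝ} (ha : 0 < a) (hm : 0 ≤ msq) {j : ℕ} (hj : 1 ≤ j) :
    (tower P a msq).term j = (B1.aSeq a P.L j ^ 2 * P.spacing j ^ 2) •
      (Grs P a msq j * Qks P j * Crs P a msq j * (Qk P j * Grs P a msq j)) := by
  have hs : P.spacing j ≠ 0 := (P.spacing_pos j).ne'
  rw [term_eq, G_eq_smul_Grs (P := P) ha hm hj, C_eq_smul_Crs (P := P) ha hm hj]
  show (B1.aSeq a P.L j ^ 2 * (P.spacing j ^ 4)⁻¹) •
      (P.spacing j ^ 2 • Grs P a msq j * Qks P j * (P.spacing j ^ 2 • Crs P a msq j) * Qk P j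
        * (P.spacing j ^ 2 • Grs P a msq j)) = _
  simp only [Matrix.smul_mul, Matrix.mul_smul, smul_smul, Matrix.mul_assoc]
  congr 1
  field_simp

/-- `Q_jG_j^{resc}` is the transpose of `G_j^{resc}Q_j^*` up to the block weight: `(Q_jG_j^{resc})(y′, x′) = L^{−jd}(G_j^{resc}Q_j^*)(x′, y′)`
(`Q_j = L^{−jd}(Q_j^*)ᵀ`, `G_j^{resc}` symmetric). [cite: Balaban1982Higgs1, (2.11)–(2.12) p.609] [folklore] -/
theorem QkGrs_apply {a msq : ℝ} {j : ℕ} (hj : j ≤ P.m + P.K) (y' : Site P j) (x' : Site P 0) :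
    (Qk P j * Grs P a msq j) y' x' = (((P.L : ℝ) ^ j) ^ P.d)⁻¹ * (Grs P a msq j * Qks P j) x' y' := by
  have hQk : Qk P j = wj P j • (Qks P j)ᵀ := by
    rw [Qk_eq, avgMat_eq_smul_transpose]
    rfl
  have hT : Qk P j * Grs P a msq j = wj P j • (Grs P a msq j * Qks P j)ᵀ := by
    rw [hQk, Matrix.smul_mul, Matrix.transpose_mul, (Grs_isSymm (P := P) a msq j).eq]
  rw [hT, Matrix.smul_apply, Matrix.transpose_apply, smul_eq_mul, wj_eq_inv P hj]

/-- **(2.34) ON THE TORUS AT KERNEL LEVEL** («G_k(□) = C^{(0),η}(□) + Σ_{j=1}^{k−1} a_j²(L^jη)^{−4}G^η_j(□)Q_j^*C^{(j),L^jη}(□)Q_jG^η_j(□)»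
with «□ replaced by the whole torus»): the `(x, x′)` entry of `G^ε_k` is
`ε²·G_0^{unit}(x,x′) + Σ_{j=1}^{k−1} a_j²(L^jε)² Σ_{y,y′} (G_j^{resc}Q_j^*)(x,y) C^{(j)}(y,y′) (Q_jG_j^{resc})(y′,x′)` (`B1RG242Torus.display243`,
kernel-proved from [1] (2.42)). [cite: Balaban1983RegularityDecay, (2.34) p.582; Balaban1984PropagatorsI, (1.135) p.39; Balaban1982Higgs1,
(2.43) p.612] -/
theorem G_apply_eq {a msq : ℝ} (ha : 0 < a) (hm : 0 ≤ msq) {k : ℕ} (hk : 1 ≤ k) (x x' : Site P 0) :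
    (tower P a msq).G k x x' = P.eps ^ 2 * G0unit P a msq x x' +
      ∑ j ∈ Finset.Ico 1 k, B1.aSeq a P.L j ^ 2 * P.spacing j ^ 2 *
        ∑ y : Site P j, ∑ y' : Site P j,
          (Grs P a msq j * Qks P j) x y * Crs P a msq j y y' * (Qk P j * Grs P a msq j) y' x' := by
  rw [display243 P ha hm k hk, Matrix.add_apply, Matrix.sum_apply, G_one_eq_smul_G0unit (P := P) ha hm,
    Matrix.smul_apply, smul_eq_mul, add_comm]
  congr 1
  refine Finset.sum_congr rfl fun j hj => ?_
  rw [term_eq_rescaled P ha hm (Finset.mem_Ico.mp hj).1, Matrix.smul_apply, smul_eq_mul, triple_apply]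

/-- The left `ε`-derivative of the rescaled block column is `(L^jε)^{−1}` times the printed kernel `K1_j = ∂^{L^{−j}}_μG_j^{resc}Q_j^*`
(`∂^ε = (L^jε)^{−1}∂^{L^{−j}}` in the units of level `j`, `B5Display136Torus.deriv_rescale`/`K1_eq`). [cite: Balaban1983RegularityDecay,
p.573 (difference derivative), (2.35) p.582] [folklore] -/
theorem derivGrsQks_apply {a msq : ℝ} (ha : 0 < a) (hm : 0 ≤ msq) {j : ℕ} (hj : 1 ≤ j) (μ : Fin P.d)
    (x : Site P 0) (y : Site P j) :
    (deriv P 0 P.eps μ * Grs P a msq j * Qks P j) x y = (P.spacing j)⁻¹ * K1 P a msq j μ x ⟨j, y⟩ := by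
  have hs : P.spacing j ≠ 0 := (P.spacing_pos j).ne'
  rw [K1_eq (P := P) ha hm hj μ x y, deriv_rescale]
  show _ = (P.spacing j)⁻¹ * ((P.spacing j • deriv P 0 P.eps μ) * Grs P a msq j * Qks P j) x y
  rw [Matrix.smul_mul, Matrix.smul_mul, Matrix.smul_apply, smul_eq_mul, ← mul_assoc, inv_mul_cancel₀ hs, one_mul]

/-- `ε²·∂^ε_μ = ε·∂¹_μ` on the fine torus (lattice units). [folklore] -/
private theorem eps_sq_deriv_eps (μ : Fin P.d) : P.eps ^ 2 • deriv P 0 P.eps μ = P.eps • deriv P 0 1 μ := by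
  have hε : P.eps ≠ 0 := P.eps_pos.ne'
  have h := deriv_rescale (P := P) (i := 0) (1 : ℝ) (P.eps)⁻¹ μ
  rw [div_inv_eq_mul, one_mul] at h
  rw [h, smul_smul, pow_two, mul_assoc, mul_inv_cancel₀ hε, mul_one]

/-- **THE LEFT DERIVATIVE OF (2.34) AT KERNEL LEVEL**: the `(x, x′)` entry of `∂^ε_μG^ε_k` is
`ε·(∂¹_μG_0^{unit})(x,x′) + Σ_{j=1}^{k−1} a_j²(L^jε) Σ_{y,y′} K1_j(μ;x,y) C^{(j)}(y,y′) (Q_jG_j^{resc})(y′,x′)` — one power of `L^jε`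
fewer than `G^ε_k` itself (B4 (2.38)). [cite: Balaban1983RegularityDecay, (2.34) p.582, (2.38) p.582; Balaban1984PropagatorsI,
(1.135) p.39] -/
theorem derivG_apply_eq {a msq : ℝ} (ha : 0 < a) (hm : 0 ≤ msq) {k : ℕ} (hk : 1 ≤ k) (μ : Fin P.d)
    (x x' : Site P 0) :
    (deriv P 0 P.eps μ * (tower P a msq).G k) x x' = P.eps * (deriv P 0 1 μ * G0unit P a msq) x x' +
      ∑ j ∈ Finset.Ico 1 k, B1.aSeq a P.L j ^ 2 * P.spacing j *
        ∑ y : Site P j, ∑ y' : Site P j,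
          K1 P a msq j μ x ⟨j, y⟩ * Crs P a msq j y y' * (Qk P j * Grs P a msq j) y' x' := by
  rw [display243 P ha hm k hk, Matrix.mul_add, Matrix.add_apply, Matrix.mul_sum, Matrix.sum_apply,
    G_one_eq_smul_G0unit (P := P) ha hm, Matrix.mul_smul, ← Matrix.smul_mul, eps_sq_deriv_eps, Matrix.smul_mul,
    Matrix.smul_apply, smul_eq_mul, add_comm]
  congr 1
  refine Finset.sum_congr rfl fun j hj => ?_
  have hj1 : 1 ≤ j := (Finset.mem_Ico.mp hj).1
  have hs : P.spacing j ≠ 0 := (P.spacing_pos j).ne'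
  rw [term_eq_rescaled P ha hm hj1, Matrix.mul_smul, Matrix.smul_apply, smul_eq_mul,
    show deriv P 0 P.eps μ * (Grs P a msq j * Qks P j * Crs P a msq j * (Qk P j * Grs P a msq j))
      = (deriv P 0 P.eps μ * Grs P a msq j * Qks P j) * Crs P a msq j * (Qk P j * Grs P a msq j) by
        simp only [Matrix.mul_assoc],
    triple_apply, Finset.mul_sum, Finset.mul_sum]
  refine Finset.sum_congr rfl fun y _ => ?_
  rw [Finset.mul_sum, Finset.mul_sum]
  refine Finset.sum_congr rfl fun y' _ => ?_
  rw [derivGrsQks_apply P ha hm hj1 μ x y]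
  field_simp

end Algebra

/-! ## §2 The `y, y′` convolution of a term of (2.34) and the block row sum against a source `f` -/

section Sums

variable (P : Params)

/-- **THE `y, y′` CONVOLUTION OF ONE TERM OF (2.34)** («applying the estimates (2.35)–(2.37)»): three kernels on the level-`j`
torus `T^{(j)}` decaying at rate `δ` from the block `u` of `x` through `y`, `y′` to the block `u′` of `x′` convolve to
`C₁C₂C₃·K_d(δ/2)²·e^{−(δ/2)|u−u′|_{T^{(j)}}}` (`B5Ineq137.conv_two_mid` with the row sums `B5Ineq137Torus.rowSum_T_le`).
[cite: Balaban1983RegularityDecay, (2.34)–(2.37) p.582, (2.38) p.582; Balaban1984PropagatorsI, (1.137) p.40] -/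
theorem conv_bound {j : ℕ} {δ C₁ C₂ C₃ : ℝ} (hδ : 0 < δ) (hC₁ : 0 ≤ C₁) (hC₂ : 0 ≤ C₂) (hC₃ : 0 ≤ C₃)
    (u u' : Site P j) (A : Site P j → ℝ) (B : Site P j → Site P j → ℝ) (E : Site P j → ℝ)
    (hA : ∀ y, |A y| ≤ C₁ * Real.exp (-(δ * T P j u y)))
    (hB : ∀ y y', |B y y'| ≤ C₂ * Real.exp (-(δ * T P j y y')))
    (hE : ∀ y', |E y'| ≤ C₃ * Real.exp (-(δ * T P j u' y'))) :
    |∑ y, ∑ y', A y * B y y' * E y'|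
      ≤ C₁ * C₂ * C₃ * B4Sect5Proof.latticeConst P.d (δ / 2) ^ 2 * Real.exp (-(δ / 2 * T P j u u')) := by
  have hR : 0 ≤ B4Sect5Proof.latticeConst P.d (δ / 2) := B4Sect5Proof.latticeConst_nonneg _ (by positivity)
  have hconv := B5Ineq137.conv_two_mid (Finset.univ : Finset (Site P j)) (fun (v : Site P j) y => T P j v y) (T P j)
    (T P j u u') u u' δ (δ / 2) (δ / 2) (B4Sect5Proof.latticeConst P.d (δ / 2))
    (B4Sect5Proof.latticeConst P.d (δ / 2)) (by positivity) (by positivity) (by linarith) hR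
    (fun y => T_nonneg P j u y) (fun y => T_nonneg P j u' y) (fun y y' => T_nonneg P j y y')
    (fun y₁ y₂ => by
      have h1 := T_triangle P j u y₁ u'
      have h2 := T_triangle P j y₁ y₂ u'
      have h3 := T_symm P j y₂ u'
      linarith)
    (rowSum_T_le P j (by positivity) u) (fun y => rowSum_T_le P j (by positivity) y)
  calc |∑ y, ∑ y', A y * B y y' * E y'|
      ≤ ∑ y, |∑ y', A y * B y y' * E y'| := Finset.abs_sum_le_sum_abs _ _
    _ ≤ ∑ y, ∑ y', |A y * B y y' * E y'| := Finset.sum_le_sum fun y _ => Finset.abs_sum_le_sum_abs _ _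
    _ ≤ ∑ y, ∑ y', C₁ * Real.exp (-(δ * T P j u y)) * (C₂ * Real.exp (-(δ * T P j y y'))) *
          (C₃ * Real.exp (-(δ * T P j u' y'))) := by
        refine Finset.sum_le_sum fun y _ => Finset.sum_le_sum fun y' _ => ?_
        rw [abs_mul, abs_mul]
        exact mul_le_mul (mul_le_mul (hA y) (hB y y') (abs_nonneg _) (by positivity)) (hE y') (abs_nonneg _)
          (by positivity)
    _ = C₁ * C₂ * C₃ * ∑ y, ∑ y', Real.exp (-(δ * T P j u y)) * Real.exp (-(δ * T P j y y')) *
          Real.exp (-(δ * T P j u' y')) := by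
        rw [Finset.mul_sum]
        refine Finset.sum_congr rfl fun y _ => ?_
        rw [Finset.mul_sum]
        refine Finset.sum_congr rfl fun y' _ => ?_
        ring
    _ ≤ C₁ * C₂ * C₃ * (B4Sect5Proof.latticeConst P.d (δ / 2) * B4Sect5Proof.latticeConst P.d (δ / 2) *
          Real.exp (-(δ / 2 * T P j u u'))) := mul_le_mul_of_nonneg_left hconv (by positivity)
    _ = C₁ * C₂ * C₃ * B4Sect5Proof.latticeConst P.d (δ / 2) ^ 2 * Real.exp (-(δ / 2 * T P j u u')) := by ring

/-- The block distance dominates the fine distance up to the block diameter: `L^j·|proj x − proj x′|_{T^{(j)}} ≥ |x − x′|_{T^{(0)}} −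
2(L^j − 1)`. [folklore] -/
private theorem T_proj_ge {j : ℕ} (hj : j ≤ P.m + P.K) (x x' : Site P 0) :
    T P 0 x x' - 2 * ((P.L : ℝ) ^ j - 1) ≤ (P.L : ℝ) ^ j * T P j (Site.proj j j x) (Site.proj j j x') := by
  have h1 := T_blk_le P hj x
  have h2 := T_blk_le P hj x'
  rw [B5Leaf235Torus.blk_eq_proj hj] at h1 h2
  have h3 := T_fine_fine P hj (Site.proj j j x) (Site.proj j j x')
  have t1 := T_triangle P 0 x (fine P j (Site.proj j j x)) x'
  have t2 := T_triangle P 0 (fine P j (Site.proj j j x)) (fine P j (Site.proj j j x')) x'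
  have t3 := T_symm P 0 (fine P j (Site.proj j j x')) x'
  linarith

/-- Block sums: a function of the block label summed over the fine torus with the weight `L^{−jd}` is its sum over `T^{(j)}`
(every `L^j`-block has `L^{jd}` fine points). [folklore] -/
private theorem sum_weight_comp_proj {j : ℕ} (hj : j ≤ P.m + P.K) (g : Site P j → ℝ) :
    ∑ x' : Site P 0, (((P.L : ℝ) ^ j) ^ P.d)⁻¹ * g (Site.proj j j x') = ∑ y : Site P j, g y := by
  have h0 : P.sitesPerDir 0 = P.L ^ j * P.sitesPerDir j := by
    rw [sitesPerDir_zero_eq P j, lvl_of_le P hj]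
  have hL : (((P.L : ℝ) ^ j) ^ P.d) ≠ 0 := pow_ne_zero _ (pow_ne_zero _ P.cast_L_pos.ne')
  rw [sum_chart P h0]
  refine Finset.sum_congr rfl fun y _ => ?_
  simp only [Site.proj_fibreSite h0]
  rw [Finset.sum_const, Finset.card_univ, Fintype.card_fun, Fintype.card_fin, Fintype.card_fin, nsmul_eq_mul]
  push_cast
  field_simp

/-- **THE BLOCK ROW SUM AGAINST A SOURCE** (the `x′`-sum of (2.38) p. 582): if `|f| ≤ F` and `f` vanishes within fine distance `D`
of `x`, then `Σ_{x′} L^{−jd} e^{−θ|proj x − proj x′|_{T^{(j)}}} |f(x′)| ≤ F·e^{θ}K_d(θ/2)·e^{−(θ/2)D/L^j}` — half the rate is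
spent on the row sum over the blocks, the other half sees the distance `D/L^j − 2` of the supporting blocks.
[cite: Balaban1983RegularityDecay, (2.38)–(2.39) p.582 with (1.10) p.573] -/
theorem block_row_sum {j : ℕ} (hj : j ≤ P.m + P.K) {θ : ℝ} (hθ : 0 < θ) (x : Site P 0) (f : Site P 0 → ℝ)
    {F D : ℝ} (hF : ∀ z, |f z| ≤ F) (hD : ∀ z, f z ≠ 0 → D ≤ T P 0 x z) :
    ∑ x' : Site P 0, (((P.L : ℝ) ^ j) ^ P.d)⁻¹ * Real.exp (-(θ * T P j (Site.proj j j x) (Site.proj j j x'))) * |f x'|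
      ≤ F * (Real.exp θ * B4Sect5Proof.latticeConst P.d (θ / 2)) *
          Real.exp (-(θ / 2 * (D / (P.L : ℝ) ^ j))) := by
  have hLj : 0 < (P.L : ℝ) ^ j := pow_pos P.cast_L_pos j
  have hF0 : 0 ≤ F := (abs_nonneg _).trans (hF x)
  have hw : 0 ≤ (((P.L : ℝ) ^ j) ^ P.d)⁻¹ := by positivity
  -- termwise: |f x′| ≤ F and, on the support, e^{−θT_j} ≤ e^{θ}e^{−(θ/2)D/L^j}·e^{−(θ/2)T_j}
  have key : ∀ x' : Site P 0,
      (((P.L : ℝ) ^ j) ^ P.d)⁻¹ * Real.exp (-(θ * T P j (Site.proj j j x) (Site.proj j j x'))) * |f x'|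
        ≤ F * (Real.exp θ * Real.exp (-(θ / 2 * (D / (P.L : ℝ) ^ j)))) *
            ((((P.L : ℝ) ^ j) ^ P.d)⁻¹ * Real.exp (-(θ / 2 * T P j (Site.proj j j x) (Site.proj j j x')))) := by
    intro x'
    by_cases hfx : f x' = 0
    · rw [hfx, abs_zero, mul_zero]
      positivity
    · have hDz := hD x' hfx
      have hge := T_proj_ge P hj x x'
      have hT0 := T_nonneg P j (Site.proj j j x) (Site.proj j j x')
      have hexp : Real.exp (-(θ * T P j (Site.proj j j x) (Site.proj j j x')))
          ≤ Real.exp θ * Real.exp (-(θ / 2 * (D / (P.L : ℝ) ^ j))) *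
              Real.exp (-(θ / 2 * T P j (Site.proj j j x) (Site.proj j j x'))) := by
        rw [← Real.exp_add, ← Real.exp_add]
        apply Real.exp_le_exp.mpr
        have hdiv : D / (P.L : ℝ) ^ j ≤ T P j (Site.proj j j x) (Site.proj j j x') + 2 := by
          rw [div_le_iff₀ hLj]
          nlinarith
        nlinarith
      calc (((P.L : ℝ) ^ j) ^ P.d)⁻¹ * Real.exp (-(θ * T P j (Site.proj j j x) (Site.proj j j x'))) * |f x'|
          ≤ (((P.L : ℝ) ^ j) ^ P.d)⁻¹ * (Real.exp θ * Real.exp (-(θ / 2 * (D / (P.L : ℝ) ^ j))) *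
              Real.exp (-(θ / 2 * T P j (Site.proj j j x) (Site.proj j j x')))) * F :=
            mul_le_mul (mul_le_mul_of_nonneg_left hexp hw) (hF x') (abs_nonneg _) (by positivity)
        _ = _ := by ring
  calc ∑ x' : Site P 0, (((P.L : ℝ) ^ j) ^ P.d)⁻¹ *
          Real.exp (-(θ * T P j (Site.proj j j x) (Site.proj j j x'))) * |f x'|
      ≤ ∑ x' : Site P 0, F * (Real.exp θ * Real.exp (-(θ / 2 * (D / (P.L : ℝ) ^ j)))) *
          ((((P.L : ℝ) ^ j) ^ P.d)⁻¹ * Real.exp (-(θ / 2 * T P j (Site.proj j j x) (Site.proj j j x')))) :=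
        Finset.sum_le_sum fun x' _ => key x'
    _ = F * (Real.exp θ * Real.exp (-(θ / 2 * (D / (P.L : ℝ) ^ j)))) *
          ∑ y : Site P j, Real.exp (-(θ / 2 * T P j (Site.proj j j x) y)) := by
        rw [← Finset.mul_sum, sum_weight_comp_proj P hj (fun y => Real.exp (-(θ / 2 * T P j (Site.proj j j x) y)))]
    _ ≤ F * (Real.exp θ * Real.exp (-(θ / 2 * (D / (P.L : ℝ) ^ j)))) * B4Sect5Proof.latticeConst P.d (θ / 2) :=
        mul_le_mul_of_nonneg_left (rowSum_T_le P j (by positivity) _) (by positivity)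
    _ = _ := by ring

/-- The fine row sum of the `j = 0` term: `Σ_{x′} e^{−δ|x−x′|_{T^{(0)}}}|f(x′)| ≤ F·K_d(δ/2)·e^{−(δ/2)D}` under the same support
hypothesis. [cite: Balaban1983RegularityDecay, (2.38) p.582 (the `C^{(0),η}` term) with (1.10) p.573] -/
theorem fine_row_sum {δ : ℝ} (hδ : 0 < δ) (x : Site P 0) (f : Site P 0 → ℝ) {F D : ℝ} (hF : ∀ z, |f z| ≤ F)
    (hD : ∀ z, f z ≠ 0 → D ≤ T P 0 x z) :
    ∑ x' : Site P 0, Real.exp (-(δ * T P 0 x x')) * |f x'|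
      ≤ F * B4Sect5Proof.latticeConst P.d (δ / 2) * Real.exp (-(δ / 2 * D)) := by
  have hF0 : 0 ≤ F := (abs_nonneg _).trans (hF x)
  have key : ∀ x' : Site P 0, Real.exp (-(δ * T P 0 x x')) * |f x'|
      ≤ F * Real.exp (-(δ / 2 * D)) * Real.exp (-(δ / 2 * T P 0 x x')) := by
    intro x'
    by_cases hfx : f x' = 0
    · rw [hfx, abs_zero, mul_zero]
      positivity
    · have hDz := hD x' hfx
      have hexp : Real.exp (-(δ * T P 0 x x')) ≤ Real.exp (-(δ / 2 * D)) * Real.exp (-(δ / 2 * T P 0 x x')) := by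
        rw [← Real.exp_add]
        exact Real.exp_le_exp.mpr (by nlinarith)
      calc Real.exp (-(δ * T P 0 x x')) * |f x'|
          ≤ (Real.exp (-(δ / 2 * D)) * Real.exp (-(δ / 2 * T P 0 x x'))) * F :=
            mul_le_mul hexp (hF x') (abs_nonneg _) (by positivity)
        _ = _ := by ring
  calc ∑ x' : Site P 0, Real.exp (-(δ * T P 0 x x')) * |f x'|
      ≤ ∑ x' : Site P 0, F * Real.exp (-(δ / 2 * D)) * Real.exp (-(δ / 2 * T P 0 x x')) :=
        Finset.sum_le_sum fun x' _ => key x'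
    _ = F * Real.exp (-(δ / 2 * D)) * ∑ x' : Site P 0, Real.exp (-(δ / 2 * T P 0 x x')) := by rw [Finset.mul_sum]
    _ ≤ F * Real.exp (-(δ / 2 * D)) * B4Sect5Proof.latticeConst P.d (δ / 2) :=
        mul_le_mul_of_nonneg_left (rowSum_T_le P 0 (by positivity) x) (by positivity)
    _ = _ := by ring

end Sums

/-! ## §3 The value and derivative clauses of (1.10) on the torus from kernel bounds (one volume, hypotheses explicit) -/

section Rows

variable (P : Params)

/-- THE KERNEL INPUTS OF THE BOX ROUTE ON THE TORUS, as hypotheses at one volume (discharged uniformly in §4 by the torus lineage: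
`B4Ineq116Torus.GQ_decay_torus`, `cov116_torus`, `B5Leaf235Torus.K13_decay_torus`): (2.35) first quantity
`|(G_j^{resc}Q_j^*)(x,y)| ≤ Ce^{−δ|proj x − y|_{T^{(j)}}}`, second quantity `|K1_j(μ;x,y)| ≤ Ce^{−δ|proj x − y|}`, and (2.37)
`|C^{(j)}(y,y′)| ≤ Ce^{−δ|y−y′|}`, at every level `1 ≤ j < k`. [cite: Balaban1983RegularityDecay, Lemma 2.4 (2.35), (2.37) p.582 with
p.572 (torus); packaging of hypotheses] -/
structure KerBounds (a msq : ℝ) (k : ℕ) (C δ : ℝ) : Prop where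
  gq : ∀ j : ℕ, 1 ≤ j → j < k → ∀ (x : Site P 0) (y : Site P j),
    |(Grs P a msq j * Qks P j) x y| ≤ C * Real.exp (-(δ * T P j (Site.proj j j x) y))
  crs : ∀ j : ℕ, 1 ≤ j → j < k → ∀ y y' : Site P j, |Crs P a msq j y y'| ≤ C * Real.exp (-(δ * T P j y y'))
  k1 : ∀ j : ℕ, 1 ≤ j → j < k → ∀ (μ : Fin P.d) (x : Site P 0) (y : Site P j),
    |K1 P a msq j μ x ⟨j, y⟩| ≤ C * Real.exp (-(δ * T P j (Site.proj j j x) y))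

/-- The constant of one term of (2.34) after the `y, y′` convolution and the block row sum:
`c_term(C, δ) = C³·K_d(δ/2)²·e^{δ/2}·K_d(δ/4)`. [folklore] -/
def cTerm (d : ℕ) (C δ : ℝ) : ℝ :=
  C ^ 3 * B4Sect5Proof.latticeConst d (δ / 2) ^ 2 * (Real.exp (δ / 2) * B4Sect5Proof.latticeConst d (δ / 4))

/-- `0 ≤ c_term` (the constant of one term of (2.38)). [cite: Balaban1983RegularityDecay, (2.38)–(2.39) p.582; constant
bookkeeping] -/
theorem cTerm_nonneg (d : ℕ) {C δ : ℝ} (hC : 0 ≤ C) (hδ : 0 < δ) : 0 ≤ cTerm d C δ := by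
  unfold cTerm
  have h1 := B4Sect5Proof.latticeConst_nonneg d (show 0 ≤ δ / 2 by positivity)
  have h2 := B4Sect5Proof.latticeConst_nonneg d (show 0 ≤ δ / 4 by positivity)
  positivity

/-- **ONE TERM OF (2.34) AGAINST A SOURCE** (value or derivative form): if the left kernel `A(x, y)` on `T^{(0)} × T^{(j)}` obeys
`|A(x,y)| ≤ Ce^{−δ|proj x − y|}` and `f` (`|f| ≤ F`) vanishes within fine distance `D ≥ 0` of `x`, then
`|Σ_{x′}[Σ_{y,y′} A(x,y)C^{(j)}(y,y′)(Q_jG_j^{resc})(y′,x′)] f(x′)| ≤ c_term·e^{−(δ/4)D/L^j}·F`. [cite: Balaban1983RegularityDecay,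
(2.34)–(2.38) p.582 with (1.10) p.573] -/
theorem term_row_bound {a msq : ℝ} {k : ℕ} {C δ : ℝ} (hC : 0 ≤ C) (hδ : 0 < δ) (hK : KerBounds P a msq k C δ)
    {j : ℕ} (hj1 : 1 ≤ j) (hjk : j < k) (hkm : k ≤ P.m + P.K) (x : Site P 0) (A : Site P 0 → Site P j → ℝ)
    (hA : ∀ (z : Site P 0) (y : Site P j), |A z y| ≤ C * Real.exp (-(δ * T P j (Site.proj j j z) y)))
    (f : Site P 0 → ℝ) {F D : ℝ} (hF : ∀ z, |f z| ≤ F) (hD : ∀ z, f z ≠ 0 → D ≤ T P 0 x z) :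
    |∑ x' : Site P 0, (∑ y : Site P j, ∑ y' : Site P j,
        A x y * Crs P a msq j y y' * (Qk P j * Grs P a msq j) y' x') * f x'|
      ≤ cTerm P.d C δ * Real.exp (-(δ / 4 * (D / (P.L : ℝ) ^ j))) * F := by
  have hj : j ≤ P.m + P.K := hjk.le.trans hkm
  have hw : 0 ≤ (((P.L : ℝ) ^ j) ^ P.d)⁻¹ := by positivity
  have hR : 0 ≤ B4Sect5Proof.latticeConst P.d (δ / 2) := B4Sect5Proof.latticeConst_nonneg _ (by positivity)
  -- the entry bound from the convolution
  have hent : ∀ x' : Site P 0,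
      |∑ y : Site P j, ∑ y' : Site P j, A x y * Crs P a msq j y y' * (Qk P j * Grs P a msq j) y' x'|
        ≤ C * C * ((((P.L : ℝ) ^ j) ^ P.d)⁻¹ * C) * B4Sect5Proof.latticeConst P.d (δ / 2) ^ 2 *
            Real.exp (-(δ / 2 * T P j (Site.proj j j x) (Site.proj j j x'))) := by
    intro x'
    refine conv_bound P hδ hC hC (mul_nonneg hw hC) (Site.proj j j x) (Site.proj j j x') (A x) (Crs P a msq j)
      (fun y' => (Qk P j * Grs P a msq j) y' x') (hA x) (hK.crs j hj1 hjk) ?_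
    intro y'
    rw [QkGrs_apply P hj, abs_mul, abs_of_nonneg hw, mul_assoc]
    exact mul_le_mul_of_nonneg_left (hK.gq j hj1 hjk x' y') hw
  have hblock := block_row_sum P hj (show 0 < δ / 2 by positivity) x f hF hD
  calc |∑ x' : Site P 0, (∑ y : Site P j, ∑ y' : Site P j,
          A x y * Crs P a msq j y y' * (Qk P j * Grs P a msq j) y' x') * f x'|
      ≤ ∑ x' : Site P 0, |(∑ y : Site P j, ∑ y' : Site P j,
          A x y * Crs P a msq j y y' * (Qk P j * Grs P a msq j) y' x') * f x'| := Finset.abs_sum_le_sum_abs _ _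
    _ ≤ ∑ x' : Site P 0, C * C * ((((P.L : ℝ) ^ j) ^ P.d)⁻¹ * C) * B4Sect5Proof.latticeConst P.d (δ / 2) ^ 2 *
            Real.exp (-(δ / 2 * T P j (Site.proj j j x) (Site.proj j j x'))) * |f x'| := by
        refine Finset.sum_le_sum fun x' _ => ?_
        rw [abs_mul]
        exact mul_le_mul_of_nonneg_right (hent x') (abs_nonneg _)
    _ = C ^ 3 * B4Sect5Proof.latticeConst P.d (δ / 2) ^ 2 *
          ∑ x' : Site P 0, (((P.L : ℝ) ^ j) ^ P.d)⁻¹ *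
            Real.exp (-(δ / 2 * T P j (Site.proj j j x) (Site.proj j j x'))) * |f x'| := by
        rw [Finset.mul_sum]
        refine Finset.sum_congr rfl fun x' _ => ?_
        ring
    _ ≤ C ^ 3 * B4Sect5Proof.latticeConst P.d (δ / 2) ^ 2 *
          (F * (Real.exp (δ / 2) * B4Sect5Proof.latticeConst P.d (δ / 2 / 2)) *
            Real.exp (-(δ / 2 / 2 * (D / (P.L : ℝ) ^ j)))) :=
        mul_le_mul_of_nonneg_left hblock (by positivity)
    _ = cTerm P.d C δ * Real.exp (-(δ / 4 * (D / (P.L : ℝ) ^ j))) * F := by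
        rw [cTerm, show δ / 2 / 2 = δ / 4 by ring]
        ring

/-- Geometric bookkeeping: `Σ_{1 ≤ j < k} L^jε ≤ L^kε/(L − 1) ≤ 1/(L − 1)` for `k ≤ K` (`L^Kε = 1`). [folklore] -/
private theorem sum_spacing_le {k : ℕ} (hk : k ≤ P.K) : ∑ j ∈ Finset.Ico 1 k, P.spacing j ≤ 1 / ((P.L : ℝ) - 1) := by
  have hL1 : (1 : ℝ) < P.L := one_lt_cast_L P
  have hL0 : (0 : ℝ) < P.L := P.cast_L_pos
  have hε : 0 < P.eps := P.eps_pos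
  have hsk : P.spacing k ≤ 1 := by rw [← P.spacing_K]; exact spacing_le_spacing P hk
  have hgeom : ∑ j ∈ Finset.range k, (P.L : ℝ) ^ j = ((P.L : ℝ) ^ k - 1) / ((P.L : ℝ) - 1) :=
    geom_sum_eq hL1.ne' k
  calc ∑ j ∈ Finset.Ico 1 k, P.spacing j
      ≤ ∑ j ∈ Finset.range k, P.spacing j := by
        refine Finset.sum_le_sum_of_subset_of_nonneg (fun j hj => ?_) (fun j _ _ => (P.spacing_pos j).le)
        exact Finset.mem_range.mpr (Finset.mem_Ico.mp hj).2
    _ = P.eps * ∑ j ∈ Finset.range k, (P.L : ℝ) ^ j := by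
        rw [Finset.mul_sum]
        exact Finset.sum_congr rfl fun j _ => by unfold Params.spacing; ring
    _ = P.eps * (((P.L : ℝ) ^ k - 1) / ((P.L : ℝ) - 1)) := by rw [hgeom]
    _ ≤ P.eps * ((P.L : ℝ) ^ k / ((P.L : ℝ) - 1)) := by
        refine mul_le_mul_of_nonneg_left (div_le_div_of_nonneg_right (by linarith) (by linarith)) hε.le
    _ = P.spacing k / ((P.L : ℝ) - 1) := by unfold Params.spacing; ring
    _ ≤ 1 / ((P.L : ℝ) - 1) := div_le_div_of_nonneg_right hsk (by linarith)

/-- For `j < k ≤ K`: `L^jε ≤ 1` and `ε ≤ 1/L^j`, so a decay on the scale `D/L^j` (fine units) is at least a decay in the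
`ε`-distance `εD`: `e^{−cD/L^j} ≤ e^{−c·εD}` (`c, D ≥ 0`) — the scale factors «L^jη ≤ 1» of (2.39).
[cite: Balaban1983RegularityDecay, (2.39) p.582; scale bookkeeping] -/
theorem exp_scale_le {k j : ℕ} (hk : k ≤ P.K) (hjk : j < k) {c D : ℝ} (hc : 0 ≤ c) (hD : 0 ≤ D) :
    Real.exp (-(c * (D / (P.L : ℝ) ^ j))) ≤ Real.exp (-(c * (P.eps * D))) := by
  have hLj : 0 < (P.L : ℝ) ^ j := pow_pos P.cast_L_pos j
  have hsj : P.spacing j ≤ 1 := by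
    rw [← P.spacing_K]; exact spacing_le_spacing P (hjk.le.trans hk)
  apply Real.exp_le_exp.mpr
  have h1 : P.eps * D ≤ D / (P.L : ℝ) ^ j := by
    rw [le_div_iff₀ hLj]
    have : P.spacing j * D ≤ 1 * D := mul_le_mul_of_nonneg_right hsj hD
    unfold Params.spacing at this
    nlinarith
  nlinarith [mul_le_mul_of_nonneg_left h1 hc]

/-- **(1.10) ON THE TORUS, VALUE CLAUSE, FROM THE KERNEL BOUNDS** (one volume, `1 ≤ k ≤ K`, `k ≤ m + K`): for every `f` with
`|f| ≤ F` vanishing within fine distance `D ≥ 0` of `x`,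
`|(G^ε_k f)(x)| ≤ (C₀K_d(δ₀/2) + a²·c_term/(L−1))·e^{−min(δ₀/2, δ/4)·εD}·F`.  Route: (2.34) at kernel level (`G_apply_eq`), the `j = 0`
term by the `C^{(0)}` kernel bound (`B5Leaf237C0Torus.G0unit_decay` form, hypothesis `hG0`) and `fine_row_sum`, the terms `j ≥ 1` by
`term_row_bound` and `Σ_j (L^jε)² ≤ Σ_j L^jε ≤ 1/(L−1)`. [cite: Balaban1983RegularityDecay, Theorem (1.10) p.573 («|(G_k(Ω,A)f)(x)| ≤
c₀exp(−δ₀dist(x,supp f))‖f‖_∞»; «for rectangular parallelepipeds, the inequalities hold … for all x»), proof route pp.582–584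
(2.34), (2.38), Lemma 2.4, p.572 (torus)] -/
theorem value_row_bound {a msq : ℝ} (ha : 0 < a) (hm : 0 ≤ msq) {k : ℕ} (hk1 : 1 ≤ k) (hkK : k ≤ P.K)
    (hkm : k ≤ P.m + P.K) {C δ C₀ δ₀ : ℝ} (hC : 0 ≤ C) (hδ : 0 < δ) (hC₀ : 0 ≤ C₀) (hδ₀ : 0 < δ₀)
    (hK : KerBounds P a msq k C δ)
    (hG0 : ∀ x x' : Site P 0, |G0unit P a msq x x'| ≤ C₀ * Real.exp (-(δ₀ * T P 0 x x')))
    (x : Site P 0) (f : Site P 0 → ℝ) {F D : ℝ} (hF : ∀ z, |f z| ≤ F) (hD0 : 0 ≤ D)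
    (hD : ∀ z, f z ≠ 0 → D ≤ T P 0 x z) :
    |((tower P a msq).G k *ᵥ f) x|
      ≤ (C₀ * B4Sect5Proof.latticeConst P.d (δ₀ / 2) + a ^ 2 * cTerm P.d C δ * (1 / ((P.L : ℝ) - 1))) *
          Real.exp (-(min (δ₀ / 2) (δ / 4) * (P.eps * D))) * F := by
  have hL1 : (1 : ℝ) < P.L := one_lt_cast_L P
  have hε1 : P.eps ≤ 1 := eps_le_one (P := P)
  have hε0 : 0 < P.eps := P.eps_pos
  have hF0 : 0 ≤ F := (abs_nonneg _).trans (hF x)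
  have hεD : 0 ≤ P.eps * D := mul_nonneg hε0.le hD0
  have hct : 0 ≤ cTerm P.d C δ := cTerm_nonneg P.d hC hδ
  set m₀ := min (δ₀ / 2) (δ / 4) with hm₀
  have hm₀0 : 0 ≤ m₀ := le_min (by positivity) (by positivity)
  -- split (G f)(x) along (2.34)
  have hsplit : ((tower P a msq).G k *ᵥ f) x
      = P.eps ^ 2 * ∑ x', G0unit P a msq x x' * f x'
        + ∑ j ∈ Finset.Ico 1 k, B1.aSeq a P.L j ^ 2 * P.spacing j ^ 2 *
            ∑ x', (∑ y : Site P j, ∑ y' : Site P j,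
              (Grs P a msq j * Qks P j) x y * Crs P a msq j y y' * (Qk P j * Grs P a msq j) y' x') * f x' := by
    have e1 : ((tower P a msq).G k *ᵥ f) x = ∑ x', (tower P a msq).G k x x' * f x' := rfl
    rw [e1]
    calc ∑ x', (tower P a msq).G k x x' * f x'
        = ∑ x', (P.eps ^ 2 * G0unit P a msq x x' * f x' +
            ∑ j ∈ Finset.Ico 1 k, B1.aSeq a P.L j ^ 2 * P.spacing j ^ 2 *
              (∑ y : Site P j, ∑ y' : Site P j,
                (Grs P a msq j * Qks P j) x y * Crs P a msq j y y' * (Qk P j * Grs P a msq j) y' x') * f x') := by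
          refine Finset.sum_congr rfl fun x' _ => ?_
          rw [G_apply_eq P ha hm hk1, add_mul, Finset.sum_mul]
      _ = _ := by
          rw [Finset.sum_add_distrib, Finset.sum_comm, Finset.mul_sum]
          congr 1
          · exact Finset.sum_congr rfl fun x' _ => by ring
          · refine Finset.sum_congr rfl fun j _ => ?_
            rw [Finset.mul_sum]
            exact Finset.sum_congr rfl fun x' _ => by ring
  -- the j = 0 row
  have h0 : |P.eps ^ 2 * ∑ x', G0unit P a msq x x' * f x'|
      ≤ C₀ * B4Sect5Proof.latticeConst P.d (δ₀ / 2) * Real.exp (-(m₀ * (P.eps * D))) * F := by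
    have hrow := fine_row_sum P hδ₀ x f hF hD
    have hε2 : P.eps ^ 2 ≤ 1 := by nlinarith
    have hexp : Real.exp (-(δ₀ / 2 * D)) ≤ Real.exp (-(m₀ * (P.eps * D))) := by
      apply Real.exp_le_exp.mpr
      have h1 : m₀ * (P.eps * D) ≤ δ₀ / 2 * (P.eps * D) := mul_le_mul_of_nonneg_right (min_le_left _ _) hεD
      have h2 : δ₀ / 2 * (P.eps * D) ≤ δ₀ / 2 * D := by
        have : P.eps * D ≤ 1 * D := mul_le_mul_of_nonneg_right hε1 hD0
        rw [one_mul] at this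
        exact mul_le_mul_of_nonneg_left this (by positivity)
      linarith
    calc |P.eps ^ 2 * ∑ x', G0unit P a msq x x' * f x'|
        = P.eps ^ 2 * |∑ x', G0unit P a msq x x' * f x'| := by rw [abs_mul, abs_of_nonneg (by positivity)]
      _ ≤ 1 * ∑ x', Real.exp (-(δ₀ * T P 0 x x')) * |f x'| * C₀ := by
          refine mul_le_mul hε2 ?_ (abs_nonneg _) zero_le_one
          calc |∑ x', G0unit P a msq x x' * f x'| ≤ ∑ x', |G0unit P a msq x x' * f x'| :=
                Finset.abs_sum_le_sum_abs _ _
            _ ≤ ∑ x', Real.exp (-(δ₀ * T P 0 x x')) * |f x'| * C₀ := by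
                refine Finset.sum_le_sum fun x' _ => ?_
                rw [abs_mul]
                calc |G0unit P a msq x x'| * |f x'| ≤ C₀ * Real.exp (-(δ₀ * T P 0 x x')) * |f x'| :=
                      mul_le_mul_of_nonneg_right (hG0 x x') (abs_nonneg _)
                  _ = _ := by ring
      _ = C₀ * ∑ x', Real.exp (-(δ₀ * T P 0 x x')) * |f x'| := by rw [one_mul, ← Finset.sum_mul]; ring
      _ ≤ C₀ * (F * B4Sect5Proof.latticeConst P.d (δ₀ / 2) * Real.exp (-(δ₀ / 2 * D))) :=
          mul_le_mul_of_nonneg_left hrow hC₀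
      _ ≤ C₀ * (F * B4Sect5Proof.latticeConst P.d (δ₀ / 2) * Real.exp (-(m₀ * (P.eps * D)))) := by
          have hR := B4Sect5Proof.latticeConst_nonneg P.d (show 0 ≤ δ₀ / 2 by positivity)
          exact mul_le_mul_of_nonneg_left (mul_le_mul_of_nonneg_left hexp (by positivity)) hC₀
      _ = _ := by ring
  -- the rows j ≥ 1
  have hj : ∀ j ∈ Finset.Ico 1 k,
      |B1.aSeq a P.L j ^ 2 * P.spacing j ^ 2 *
          ∑ x', (∑ y : Site P j, ∑ y' : Site P j,
            (Grs P a msq j * Qks P j) x y * Crs P a msq j y y' * (Qk P j * Grs P a msq j) y' x') * f x'|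
        ≤ a ^ 2 * cTerm P.d C δ * Real.exp (-(m₀ * (P.eps * D))) * F * P.spacing j := by
    intro j hjm
    obtain ⟨hj1, hjk⟩ := Finset.mem_Ico.mp hjm
    have ht := term_row_bound P hC hδ hK hj1 hjk hkm x (fun z y => (Grs P a msq j * Qks P j) z y)
      (hK.gq j hj1 hjk) f hF hD
    have haj : B1.aSeq a P.L j ^ 2 ≤ a ^ 2 := by
      have := B5Leaf235Torus.abs_aSeq_le ha hL1 j
      rw [← sq_abs]; exact pow_le_pow_left₀ (abs_nonneg _) this 2
    have hs1 : P.spacing j ≤ 1 := by rw [← P.spacing_K]; exact spacing_le_spacing P (hjk.le.trans hkK)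
    have hs0 : 0 ≤ P.spacing j := (P.spacing_pos j).le
    have hs2 : P.spacing j ^ 2 ≤ P.spacing j := by nlinarith
    have hexp : Real.exp (-(δ / 4 * (D / (P.L : ℝ) ^ j))) ≤ Real.exp (-(m₀ * (P.eps * D))) :=
      (exp_scale_le P hkK hjk (by positivity) hD0).trans
        (Real.exp_le_exp.mpr (by nlinarith [mul_le_mul_of_nonneg_right (min_le_right (δ₀ / 2) (δ / 4)) hεD]))
    rw [abs_mul, abs_of_nonneg (by positivity)]
    calc B1.aSeq a P.L j ^ 2 * P.spacing j ^ 2 *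
          |∑ x', (∑ y : Site P j, ∑ y' : Site P j,
            (Grs P a msq j * Qks P j) x y * Crs P a msq j y y' * (Qk P j * Grs P a msq j) y' x') * f x'|
        ≤ a ^ 2 * P.spacing j * (cTerm P.d C δ * Real.exp (-(m₀ * (P.eps * D))) * F) :=
          mul_le_mul (mul_le_mul haj hs2 (by positivity) (by positivity))
            (ht.trans (mul_le_mul_of_nonneg_right (mul_le_mul_of_nonneg_left hexp hct) hF0)) (abs_nonneg _)
            (by positivity)
      _ = _ := by ring
  rw [hsplit]
  calc |P.eps ^ 2 * ∑ x', G0unit P a msq x x' * f x' +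
        ∑ j ∈ Finset.Ico 1 k, B1.aSeq a P.L j ^ 2 * P.spacing j ^ 2 *
          ∑ x', (∑ y : Site P j, ∑ y' : Site P j,
            (Grs P a msq j * Qks P j) x y * Crs P a msq j y y' * (Qk P j * Grs P a msq j) y' x') * f x'|
      ≤ |P.eps ^ 2 * ∑ x', G0unit P a msq x x' * f x'| +
        ∑ j ∈ Finset.Ico 1 k, |B1.aSeq a P.L j ^ 2 * P.spacing j ^ 2 *
          ∑ x', (∑ y : Site P j, ∑ y' : Site P j,
            (Grs P a msq j * Qks P j) x y * Crs P a msq j y y' * (Qk P j * Grs P a msq j) y' x') * f x'| :=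
        (abs_add_le _ _).trans (add_le_add le_rfl (Finset.abs_sum_le_sum_abs _ _))
    _ ≤ C₀ * B4Sect5Proof.latticeConst P.d (δ₀ / 2) * Real.exp (-(m₀ * (P.eps * D))) * F +
        ∑ j ∈ Finset.Ico 1 k, a ^ 2 * cTerm P.d C δ * Real.exp (-(m₀ * (P.eps * D))) * F * P.spacing j :=
        add_le_add h0 (Finset.sum_le_sum hj)
    _ = C₀ * B4Sect5Proof.latticeConst P.d (δ₀ / 2) * Real.exp (-(m₀ * (P.eps * D))) * F +
        a ^ 2 * cTerm P.d C δ * Real.exp (-(m₀ * (P.eps * D))) * F * ∑ j ∈ Finset.Ico 1 k, P.spacing j := by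
        rw [Finset.mul_sum]
    _ ≤ C₀ * B4Sect5Proof.latticeConst P.d (δ₀ / 2) * Real.exp (-(m₀ * (P.eps * D))) * F +
        a ^ 2 * cTerm P.d C δ * Real.exp (-(m₀ * (P.eps * D))) * F * (1 / ((P.L : ℝ) - 1)) :=
        add_le_add le_rfl (mul_le_mul_of_nonneg_left (sum_spacing_le P hkK)
          (by positivity : (0 : ℝ) ≤ a ^ 2 * cTerm P.d C δ * Real.exp (-(m₀ * (P.eps * D))) * F))
    _ = _ := by ring

/-- The left unit derivative of the `C^{(0)}` kernel decays like the kernel: `|(∂¹_μG_0^{unit})(x,x′)| = |G_0^{unit}(x+e_μ,x′) −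
G_0^{unit}(x,x′)| ≤ 2C₀e^{δ₀}e^{−δ₀|x−x′|}` (a unit shift moves the point by `≤ 1`, `B5Leaf237C0Torus.T_shift_le_one`).
[cite: Balaban1983RegularityDecay, (2.37) p.582 at `j = 0`, p.573 (difference derivative)] [folklore] -/
theorem derivG0unit_bound {a msq : ℝ} {C₀ δ₀ : ℝ} (hC₀ : 0 ≤ C₀) (hδ₀ : 0 < δ₀)
    (hG0 : ∀ x x' : Site P 0, |G0unit P a msq x x'| ≤ C₀ * Real.exp (-(δ₀ * T P 0 x x'))) (μ : Fin P.d)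
    (x x' : Site P 0) :
    |(deriv P 0 1 μ * G0unit P a msq) x x'| ≤ 2 * C₀ * Real.exp δ₀ * Real.exp (-(δ₀ * T P 0 x x')) := by
  rw [B5Leaf235Torus.deriv_mul_apply, inv_one, one_mul]
  have h1 := hG0 (Site.shift x μ) x'
  have h2 := hG0 x x'
  have hs := T_shift_le_one P x μ
  have ht := T_triangle P 0 x (Site.shift x μ) x'
  have e1 : Real.exp (-(δ₀ * T P 0 (Site.shift x μ) x')) ≤ Real.exp δ₀ * Real.exp (-(δ₀ * T P 0 x x')) := by
    rw [← Real.exp_add]; exact Real.exp_le_exp.mpr (by nlinarith)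
  have e2 : Real.exp (-(δ₀ * T P 0 x x')) ≤ Real.exp δ₀ * Real.exp (-(δ₀ * T P 0 x x')) :=
    le_mul_of_one_le_left (Real.exp_pos _).le (Real.one_le_exp hδ₀.le)
  calc |G0unit P a msq (Site.shift x μ) x' - G0unit P a msq x x'|
      ≤ |G0unit P a msq (Site.shift x μ) x'| + |G0unit P a msq x x'| := abs_sub _ _
    _ ≤ C₀ * (Real.exp δ₀ * Real.exp (-(δ₀ * T P 0 x x'))) + C₀ * (Real.exp δ₀ * Real.exp (-(δ₀ * T P 0 x x'))) :=
        add_le_add (h1.trans (mul_le_mul_of_nonneg_left e1 hC₀)) (h2.trans (mul_le_mul_of_nonneg_left e2 hC₀))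
    _ = 2 * C₀ * Real.exp δ₀ * Real.exp (-(δ₀ * T P 0 x x')) := by ring

/-- **(1.10) ON THE TORUS, DERIVATIVE CLAUSE, FROM THE KERNEL BOUNDS** (one volume, `1 ≤ k ≤ K`, `k ≤ m + K`): for every `f` with
`|f| ≤ F` vanishing within fine distance `D ≥ 0` of `x` and every direction `μ`,
`|(∂^ε_μG^ε_k f)(x)| ≤ (2C₀e^{δ₀}K_d(δ₀/2) + a²·c_term/(L−1))·e^{−min(δ₀/2, δ/4)·εD}·F` — one power of `L^jε` per term
instead of two (B4 (2.38)), the `j = 0` term `ε·∂¹G_0^{unit}` with `ε ≤ 1`. [cite: Balaban1983RegularityDecay, Theorem (1.10) p.573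
(«|(D^η_{A,μ}G_k(Ω,A)f)(x)| ≤ c₀exp(−δ₀dist(x,supp f))‖f‖_∞»), proof route pp.582–584 (2.34), (2.38), Lemma 2.4, p.572 (torus)] -/
theorem deriv_row_bound {a msq : ℝ} (ha : 0 < a) (hm : 0 ≤ msq) {k : ℕ} (hk1 : 1 ≤ k) (hkK : k ≤ P.K)
    (hkm : k ≤ P.m + P.K) {C δ C₀ δ₀ : ℝ} (hC : 0 ≤ C) (hδ : 0 < δ) (hC₀ : 0 ≤ C₀) (hδ₀ : 0 < δ₀)
    (hK : KerBounds P a msq k C δ)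
    (hG0 : ∀ x x' : Site P 0, |G0unit P a msq x x'| ≤ C₀ * Real.exp (-(δ₀ * T P 0 x x')))
    (μ : Fin P.d) (x : Site P 0) (f : Site P 0 → ℝ) {F D : ℝ} (hF : ∀ z, |f z| ≤ F) (hD0 : 0 ≤ D)
    (hD : ∀ z, f z ≠ 0 → D ≤ T P 0 x z) :
    |((deriv P 0 P.eps μ * (tower P a msq).G k) *ᵥ f) x|
      ≤ (2 * C₀ * Real.exp δ₀ * B4Sect5Proof.latticeConst P.d (δ₀ / 2) +
          a ^ 2 * cTerm P.d C δ * (1 / ((P.L : ℝ) - 1))) *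
          Real.exp (-(min (δ₀ / 2) (δ / 4) * (P.eps * D))) * F := by
  have hL1 : (1 : ℝ) < P.L := one_lt_cast_L P
  have hε1 : P.eps ≤ 1 := eps_le_one (P := P)
  have hε0 : 0 < P.eps := P.eps_pos
  have hF0 : 0 ≤ F := (abs_nonneg _).trans (hF x)
  have hεD : 0 ≤ P.eps * D := mul_nonneg hε0.le hD0
  have hct : 0 ≤ cTerm P.d C δ := cTerm_nonneg P.d hC hδ
  set m₀ := min (δ₀ / 2) (δ / 4) with hm₀
  have hm₀0 : 0 ≤ m₀ := le_min (by positivity) (by positivity)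
  -- split (∂G f)(x) along (2.34)
  have hsplit : ((deriv P 0 P.eps μ * (tower P a msq).G k) *ᵥ f) x
      = P.eps * ∑ x', (deriv P 0 1 μ * G0unit P a msq) x x' * f x'
        + ∑ j ∈ Finset.Ico 1 k, B1.aSeq a P.L j ^ 2 * P.spacing j *
            ∑ x', (∑ y : Site P j, ∑ y' : Site P j,
              K1 P a msq j μ x ⟨j, y⟩ * Crs P a msq j y y' * (Qk P j * Grs P a msq j) y' x') * f x' := by
    have e1 : ((deriv P 0 P.eps μ * (tower P a msq).G k) *ᵥ f) x
        = ∑ x', (deriv P 0 P.eps μ * (tower P a msq).G k) x x' * f x' := rfl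
    rw [e1]
    calc ∑ x', (deriv P 0 P.eps μ * (tower P a msq).G k) x x' * f x'
        = ∑ x', (P.eps * (deriv P 0 1 μ * G0unit P a msq) x x' * f x' +
            ∑ j ∈ Finset.Ico 1 k, B1.aSeq a P.L j ^ 2 * P.spacing j *
              (∑ y : Site P j, ∑ y' : Site P j,
                K1 P a msq j μ x ⟨j, y⟩ * Crs P a msq j y y' * (Qk P j * Grs P a msq j) y' x') * f x') := by
          refine Finset.sum_congr rfl fun x' _ => ?_
          rw [derivG_apply_eq P ha hm hk1, add_mul, Finset.sum_mul]
      _ = _ := by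
          rw [Finset.sum_add_distrib, Finset.sum_comm, Finset.mul_sum]
          congr 1
          · exact Finset.sum_congr rfl fun x' _ => by ring
          · refine Finset.sum_congr rfl fun j _ => ?_
            rw [Finset.mul_sum]
            exact Finset.sum_congr rfl fun x' _ => by ring
  -- the j = 0 row
  have h0 : |P.eps * ∑ x', (deriv P 0 1 μ * G0unit P a msq) x x' * f x'|
      ≤ 2 * C₀ * Real.exp δ₀ * B4Sect5Proof.latticeConst P.d (δ₀ / 2) * Real.exp (-(m₀ * (P.eps * D))) * F := by
    have hrow := fine_row_sum P hδ₀ x f hF hD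
    have hexp : Real.exp (-(δ₀ / 2 * D)) ≤ Real.exp (-(m₀ * (P.eps * D))) := by
      apply Real.exp_le_exp.mpr
      have h1 : m₀ * (P.eps * D) ≤ δ₀ / 2 * (P.eps * D) := mul_le_mul_of_nonneg_right (min_le_left _ _) hεD
      have h2 : δ₀ / 2 * (P.eps * D) ≤ δ₀ / 2 * D := by
        have : P.eps * D ≤ 1 * D := mul_le_mul_of_nonneg_right hε1 hD0
        rw [one_mul] at this
        exact mul_le_mul_of_nonneg_left this (by positivity)
      linarith
    have hdb := derivG0unit_bound P hC₀ hδ₀ hG0 μ x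
    calc |P.eps * ∑ x', (deriv P 0 1 μ * G0unit P a msq) x x' * f x'|
        = P.eps * |∑ x', (deriv P 0 1 μ * G0unit P a msq) x x' * f x'| := by rw [abs_mul, abs_of_nonneg hε0.le]
      _ ≤ 1 * (∑ x', Real.exp (-(δ₀ * T P 0 x x')) * |f x'| * (2 * C₀ * Real.exp δ₀)) := by
          refine mul_le_mul hε1 ?_ (abs_nonneg _) zero_le_one
          calc |∑ x', (deriv P 0 1 μ * G0unit P a msq) x x' * f x'|
              ≤ ∑ x', |(deriv P 0 1 μ * G0unit P a msq) x x' * f x'| := Finset.abs_sum_le_sum_abs _ _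
            _ ≤ ∑ x', Real.exp (-(δ₀ * T P 0 x x')) * |f x'| * (2 * C₀ * Real.exp δ₀) := by
                refine Finset.sum_le_sum fun x' _ => ?_
                rw [abs_mul]
                calc |(deriv P 0 1 μ * G0unit P a msq) x x'| * |f x'|
                    ≤ 2 * C₀ * Real.exp δ₀ * Real.exp (-(δ₀ * T P 0 x x')) * |f x'| :=
                      mul_le_mul_of_nonneg_right (hdb x') (abs_nonneg _)
                  _ = _ := by ring
      _ = 2 * C₀ * Real.exp δ₀ * ∑ x', Real.exp (-(δ₀ * T P 0 x x')) * |f x'| := by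
          rw [one_mul, ← Finset.sum_mul]; ring
      _ ≤ 2 * C₀ * Real.exp δ₀ * (F * B4Sect5Proof.latticeConst P.d (δ₀ / 2) * Real.exp (-(δ₀ / 2 * D))) :=
          mul_le_mul_of_nonneg_left hrow (by positivity)
      _ ≤ 2 * C₀ * Real.exp δ₀ * (F * B4Sect5Proof.latticeConst P.d (δ₀ / 2) * Real.exp (-(m₀ * (P.eps * D)))) := by
          have hR := B4Sect5Proof.latticeConst_nonneg P.d (show 0 ≤ δ₀ / 2 by positivity)
          exact mul_le_mul_of_nonneg_left (mul_le_mul_of_nonneg_left hexp (by positivity)) (by positivity)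
      _ = _ := by ring
  -- the rows j ≥ 1
  have hj : ∀ j ∈ Finset.Ico 1 k,
      |B1.aSeq a P.L j ^ 2 * P.spacing j *
          ∑ x', (∑ y : Site P j, ∑ y' : Site P j,
            K1 P a msq j μ x ⟨j, y⟩ * Crs P a msq j y y' * (Qk P j * Grs P a msq j) y' x') * f x'|
        ≤ a ^ 2 * cTerm P.d C δ * Real.exp (-(m₀ * (P.eps * D))) * F * P.spacing j := by
    intro j hjm
    obtain ⟨hj1, hjk⟩ := Finset.mem_Ico.mp hjm
    have ht := term_row_bound P hC hδ hK hj1 hjk hkm x (fun z y => K1 P a msq j μ z ⟨j, y⟩)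
      (hK.k1 j hj1 hjk μ) f hF hD
    have haj : B1.aSeq a P.L j ^ 2 ≤ a ^ 2 := by
      have := B5Leaf235Torus.abs_aSeq_le ha hL1 j
      rw [← sq_abs]; exact pow_le_pow_left₀ (abs_nonneg _) this 2
    have hs0 : 0 ≤ P.spacing j := (P.spacing_pos j).le
    have hexp : Real.exp (-(δ / 4 * (D / (P.L : ℝ) ^ j))) ≤ Real.exp (-(m₀ * (P.eps * D))) :=
      (exp_scale_le P hkK hjk (by positivity) hD0).trans
        (Real.exp_le_exp.mpr (by nlinarith [mul_le_mul_of_nonneg_right (min_le_right (δ₀ / 2) (δ / 4)) hεD]))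
    rw [abs_mul, abs_of_nonneg (by positivity)]
    calc B1.aSeq a P.L j ^ 2 * P.spacing j *
          |∑ x', (∑ y : Site P j, ∑ y' : Site P j,
            K1 P a msq j μ x ⟨j, y⟩ * Crs P a msq j y y' * (Qk P j * Grs P a msq j) y' x') * f x'|
        ≤ a ^ 2 * P.spacing j * (cTerm P.d C δ * Real.exp (-(m₀ * (P.eps * D))) * F) :=
          mul_le_mul (mul_le_mul haj le_rfl hs0 (by positivity))
            (ht.trans (mul_le_mul_of_nonneg_right (mul_le_mul_of_nonneg_left hexp hct) hF0)) (abs_nonneg _)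
            (by positivity)
      _ = _ := by ring
  rw [hsplit]
  calc |P.eps * ∑ x', (deriv P 0 1 μ * G0unit P a msq) x x' * f x' +
        ∑ j ∈ Finset.Ico 1 k, B1.aSeq a P.L j ^ 2 * P.spacing j *
          ∑ x', (∑ y : Site P j, ∑ y' : Site P j,
            K1 P a msq j μ x ⟨j, y⟩ * Crs P a msq j y y' * (Qk P j * Grs P a msq j) y' x') * f x'|
      ≤ |P.eps * ∑ x', (deriv P 0 1 μ * G0unit P a msq) x x' * f x'| +
        ∑ j ∈ Finset.Ico 1 k, |B1.aSeq a P.L j ^ 2 * P.spacing j *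
          ∑ x', (∑ y : Site P j, ∑ y' : Site P j,
            K1 P a msq j μ x ⟨j, y⟩ * Crs P a msq j y y' * (Qk P j * Grs P a msq j) y' x') * f x'| :=
        (abs_add_le _ _).trans (add_le_add le_rfl (Finset.abs_sum_le_sum_abs _ _))
    _ ≤ 2 * C₀ * Real.exp δ₀ * B4Sect5Proof.latticeConst P.d (δ₀ / 2) * Real.exp (-(m₀ * (P.eps * D))) * F +
        ∑ j ∈ Finset.Ico 1 k, a ^ 2 * cTerm P.d C δ * Real.exp (-(m₀ * (P.eps * D))) * F * P.spacing j :=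
        add_le_add h0 (Finset.sum_le_sum hj)
    _ = 2 * C₀ * Real.exp δ₀ * B4Sect5Proof.latticeConst P.d (δ₀ / 2) * Real.exp (-(m₀ * (P.eps * D))) * F +
        a ^ 2 * cTerm P.d C δ * Real.exp (-(m₀ * (P.eps * D))) * F * ∑ j ∈ Finset.Ico 1 k, P.spacing j := by
        rw [Finset.mul_sum]
    _ ≤ 2 * C₀ * Real.exp δ₀ * B4Sect5Proof.latticeConst P.d (δ₀ / 2) * Real.exp (-(m₀ * (P.eps * D))) * F +
        a ^ 2 * cTerm P.d C δ * Real.exp (-(m₀ * (P.eps * D))) * F * (1 / ((P.L : ℝ) - 1)) :=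
        add_le_add le_rfl (mul_le_mul_of_nonneg_left (sum_spacing_le P hkK)
          (by positivity : (0 : ℝ) ≤ a ^ 2 * cTerm P.d C δ * Real.exp (-(m₀ * (P.eps * D))) * F))
    _ = _ := by ring

end Rows

/-! ## §4 The kernel inputs for the concrete tower (torus lineage) and (1.10) on the torus, uniformly -/

section Uniform

/-- The block distance of `proj x` to `y` is at most the rescaled fine distance `d_{XU}(x,(j,y))` plus one (the converse of
`B5Leaf235Torus.dXU_le_T_add_one`): the rescaled distance `|(L^jη)^{−1}x − y|` of (1.136) against the block label.
[cite: Balaban1984PropagatorsI, (1.136) p.40; dictionary] -/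
theorem T_proj_le_dXU_add_one (P : Params) {j : ℕ} (hj : j ≤ P.m + P.K) (x : Site P 0) (y : Site P j) :
    T P j (Site.proj j j x) y ≤ dXU P j x ⟨j, y⟩ + 1 := by
  have hLj : (0 : ℝ) < (P.L : ℝ) ^ j := pow_pos P.cast_L_pos _
  have h1 := T_blk_le P hj x
  rw [B5Leaf235Torus.blk_eq_proj hj] at h1
  have h2 := T_fine_fine P hj (Site.proj j j x) y
  have t := T_triangle P 0 (fine P j (Site.proj j j x)) x (fine P j y)
  have ts := T_symm P 0 x (fine P j (Site.proj j j x))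
  have hd : dXU P j x ⟨j, y⟩ = ((P.L : ℝ) ^ j)⁻¹ * T P 0 x (fine P j y) := rfl
  rw [hd]
  have key : (P.L : ℝ) ^ j * T P j (Site.proj j j x) y ≤ T P 0 x (fine P j y) + (P.L : ℝ) ^ j := by nlinarith
  calc T P j (Site.proj j j x) y = ((P.L : ℝ) ^ j)⁻¹ * ((P.L : ℝ) ^ j * T P j (Site.proj j j x) y) := by
        field_simp
    _ ≤ ((P.L : ℝ) ^ j)⁻¹ * (T P 0 x (fine P j y) + (P.L : ℝ) ^ j) := mul_le_mul_of_nonneg_left key (by positivity)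
    _ = ((P.L : ℝ) ^ j)⁻¹ * T P 0 x (fine P j y) + 1 := by field_simp

/-- **THE KERNEL INPUTS HOLD FOR THE CONCRETE TOWER, UNIFORMLY** (one pair `C, δ` for all volumes with `P.d = d`, `P.L = L`, every
level `k ≤ m + K` under the mass cap at `k`): (2.35) first quantity `B4Ineq116Torus.GQ_decay_torus`, second quantity
`B5Leaf235Torus.K13_decay_torus` (converted from `d_{XU}` to the block distance), (2.37) `B4Ineq116Torus.cov116_torus`.
[cite: Balaban1983RegularityDecay, Lemma 2.4 (2.35), (2.37) p.582 with p.572 (torus); Balaban1984PropagatorsI p.39] -/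
theorem kerBounds_torus (d L : ℕ) (hd : 1 ≤ d) (hL : Odd L ∧ 1 < L) {a : ℝ} (ha : 0 < a) (m2plus : ℝ) :
    ∃ C δ : ℝ, 0 ≤ C ∧ 0 < δ ∧ ∀ (P : Params), P.d = d → P.L = L → ∀ (msq : ℝ), 0 ≤ msq →
      ∀ k : ℕ, k ≤ P.m + P.K → P.spacing k ^ 2 * msq ≤ m2plus → KerBounds P a msq k C δ := by
  obtain ⟨κ₁, C₁, hκ₁, hC₁, H1⟩ := GQ_decay_torus d L hd hL ha m2plus
  obtain ⟨δ₂, c₂, hδ₂, hc₂, H2⟩ := B5Leaf235Torus.K13_decay_torus d L hd hL ha m2plus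
  obtain ⟨δ₃, c₃, hδ₃, hc₃, H3⟩ := cov116_torus d L hd hL ha m2plus
  refine ⟨max C₁ (max (c₂ * Real.exp δ₂) c₃), min κ₁ (min δ₂ δ₃), le_max_of_le_left hC₁, lt_min hκ₁ (lt_min hδ₂ hδ₃), ?_⟩
  intro P hPd hPL msq hmsq k hk hcap
  have hcapj : ∀ j, j < k → P.spacing j ^ 2 * msq ≤ m2plus := fun j hjk =>
    le_trans (mul_le_mul_of_nonneg_right (pow_le_pow_left₀ (P.spacing_pos j).le (spacing_le_spacing P hjk.le) 2) hmsq) hcap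
  refine ⟨?_, ?_, ?_⟩
  · intro j hj1 hjk x y
    have h := (H1 P hPd hPL msq hmsq j hj1 (hjk.le.trans hk) (hcapj j hjk)).1 x y
    exact decay_mono (T_nonneg P j _ _) (le_max_left _ _) hC₁ (min_le_left _ _) h
  · intro j hj1 hjk y y'
    have h := H3 P hPd hPL msq hmsq j hj1 (hjk.le.trans hk) (hcapj j hjk) y y'
    exact decay_mono (T_nonneg P j _ _) ((le_max_right _ _).trans (le_max_right _ _)) hc₃
      ((min_le_right _ _).trans (min_le_right _ _)) h
  · intro j hj1 hjk μ x y
    have h := (H2 P hPd hPL msq hmsq k hk hcap j hj1 hjk).1 μ x ⟨j, y⟩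
    have hd' := T_proj_le_dXU_add_one P (hjk.le.trans hk) x y
    have h' : |K1 P a msq j μ x ⟨j, y⟩| ≤ c₂ * Real.exp δ₂ * Real.exp (-(δ₂ * T P j (Site.proj j j x) y)) := by
      refine h.trans ?_
      rw [mul_assoc, ← Real.exp_add]
      exact mul_le_mul_of_nonneg_left (Real.exp_le_exp.mpr (by nlinarith)) hc₂
    exact decay_mono (T_nonneg P j _ _) ((le_max_left _ _).trans (le_max_right _ _)) (by positivity)
      ((min_le_right _ _).trans (min_le_left _ _)) h'

/-- **B4 THEOREM (1.10) ON THE TORUS AT `A = 0` — VALUE AND DERIVATIVE CLAUSES, UNIFORMLY IN THE VOLUME AND THE SCALE.**  For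
`d ≥ 1`, odd `L > 1`, `a > 0` and `m² ≥ 0` there are `δ₀ > 0`, `c₀ > 0` (functions of `d, L, a, m²` only: «independent of A, k, Ω»)
such that for EVERY volume `P = (d, L, m, K)` of Bałaban's scalar torus tower, every level `1 ≤ k ≤ K` (`G^ε_k = G_k(T_ε, 0)` at
`k = K`: `η = ε = L^{−K}`, unit blocks), every fine site `x`, every direction `μ` and every source `f` with `|f| ≤ F` vanishing within
fine sup-distance `D ≥ 0` of `x`:
`|(G^ε_k f)(x)| ≤ c₀e^{−δ₀·εD}F` and `|(∂^ε_μG^ε_k f)(x)| ≤ c₀e^{−δ₀·εD}F` — the printed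
`|(D^η_μG_kf)(x)|, |(G_kf)(x)| ≤ c₀exp(−δ₀dist(x, supp f))‖f‖_∞` with `dist = εD` the `η`-scaled sup torus distance and no
restriction on `x` («for rectangular parallelepipeds … for all x»; the torus is the periodic parallelepiped of p. 572).  ROUTE: the
print's box route pp. 582–584 — (2.34) (`B1RG242Torus.display243`) with Lemma 2.4 on the torus (`kerBounds_torus`) and the `C^{(0)}`
kernel (`B5Leaf237C0Torus.G0unit_decay`). [cite: Balaban1983RegularityDecay, Theorem (1.10) p.573, (2.34)–(2.39) pp.582, p.584 («This part
of the argument is valid for an arbitrary rectangular parallelepiped»), p.572 (torus); Balaban1984PropagatorsI p.39 («with □ replaced by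
the whole torus»)] -/
theorem thm110_zero_torus (d L : ℕ) (hd : 1 ≤ d) (hL : Odd L ∧ 1 < L) {a : ℝ} (ha : 0 < a) {msq : ℝ} (hmsq : 0 ≤ msq) :
    ∃ δ₀ c₀ : ℝ, 0 < δ₀ ∧ 0 < c₀ ∧ ∀ (P : Params), P.d = d → P.L = L →
      ∀ k : ℕ, 1 ≤ k → k ≤ P.K → ∀ (x : Site P 0) (f : Site P 0 → ℝ) (F D : ℝ),
        (∀ z, |f z| ≤ F) → 0 ≤ D → (∀ z, f z ≠ 0 → D ≤ T P 0 x z) →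
          |((tower P a msq).G k *ᵥ f) x| ≤ c₀ * Real.exp (-(δ₀ * (P.eps * D))) * F ∧
          ∀ μ : Fin P.d, |((deriv P 0 P.eps μ * (tower P a msq).G k) *ᵥ f) x|
            ≤ c₀ * Real.exp (-(δ₀ * (P.eps * D))) * F := by
  obtain ⟨C, δ, hC, hδ, hK⟩ := kerBounds_torus d L hd hL ha msq
  -- the j = 0 constants depend on d, L, a, m² only; read them off any volume with these d, L
  have hP0 : ∃ P₀ : Params, P₀.d = d ∧ P₀.L = L := ⟨⟨d, L, 0, 0, hd, hL⟩, rfl, rfl⟩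
  obtain ⟨P₀, hP₀d, hP₀L⟩ := hP0
  set C₀ := 2 / gamma0 L a with hC₀def
  set δ₀ := dK0 d L a msq with hδ₀def
  have hC₀ : 0 ≤ C₀ := by
    rw [hC₀def, ← hP₀L]; exact (div_pos two_pos (gamma0_pos (P := P₀) ha)).le
  have hδ₀ : 0 < δ₀ := by rw [hδ₀def, ← hP₀d, ← hP₀L]; exact dK0_pos (P := P₀) ha hmsq
  have hL1 : (1 : ℝ) < L := by exact_mod_cast hL.2
  refine ⟨min (δ₀ / 2) (δ / 4),
    (max C₀ (2 * C₀ * Real.exp δ₀)) * B4Sect5Proof.latticeConst d (δ₀ / 2) + a ^ 2 * cTerm d C δ * (1 / ((L : ℝ) - 1)) + 1,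
    lt_min (by positivity) (by positivity), ?_, ?_⟩
  · have h1 := B4Sect5Proof.latticeConst_nonneg d (show 0 ≤ δ₀ / 2 by positivity)
    have h2 := cTerm_nonneg d hC hδ
    have h3 : 0 ≤ 1 / ((L : ℝ) - 1) := by apply div_nonneg zero_le_one; linarith
    positivity
  intro P hPd hPL k hk1 hkK x f F D hF hD0 hD
  have hkm : k ≤ P.m + P.K := hkK.trans (Nat.le_add_left _ _)
  have hcap : P.spacing k ^ 2 * msq ≤ msq := by
    have hs1 : P.spacing k ≤ 1 := by rw [← P.spacing_K]; exact spacing_le_spacing P hkK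
    have hs0 := (P.spacing_pos k).le
    calc P.spacing k ^ 2 * msq ≤ 1 * msq := mul_le_mul_of_nonneg_right (pow_le_one₀ hs0 hs1) hmsq
      _ = msq := one_mul _
  have hKB := hK P hPd hPL msq hmsq k hkm hcap
  subst hPd hPL
  have hG0 : ∀ x x' : Site P 0, |G0unit P a msq x x'| ≤ C₀ * Real.exp (-(δ₀ * T P 0 x x')) :=
    fun x x' => G0unit_decay (P := P) ha hmsq x x'
  have hF0 : 0 ≤ F := (abs_nonneg _).trans (hF x)
  have h1 := B4Sect5Proof.latticeConst_nonneg P.d (show 0 ≤ δ₀ / 2 by positivity)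
  have h2 := cTerm_nonneg P.d hC hδ
  have h3 : 0 ≤ 1 / ((P.L : ℝ) - 1) := by apply div_nonneg zero_le_one; linarith
  have hE : 0 ≤ Real.exp (-(min (δ₀ / 2) (δ / 4) * (P.eps * D))) * F := mul_nonneg (Real.exp_pos _).le hF0
  set cBig := max C₀ (2 * C₀ * Real.exp δ₀) * B4Sect5Proof.latticeConst P.d (δ₀ / 2) +
    a ^ 2 * cTerm P.d C δ * (1 / ((P.L : ℝ) - 1)) + 1 with hcBig
  have hv : C₀ * B4Sect5Proof.latticeConst P.d (δ₀ / 2) + a ^ 2 * cTerm P.d C δ * (1 / ((P.L : ℝ) - 1)) ≤ cBig := by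
    have := mul_le_mul_of_nonneg_right (le_max_left C₀ (2 * C₀ * Real.exp δ₀)) h1
    rw [hcBig]; linarith
  have hdv : 2 * C₀ * Real.exp δ₀ * B4Sect5Proof.latticeConst P.d (δ₀ / 2) +
      a ^ 2 * cTerm P.d C δ * (1 / ((P.L : ℝ) - 1)) ≤ cBig := by
    have := mul_le_mul_of_nonneg_right (le_max_right C₀ (2 * C₀ * Real.exp δ₀)) h1
    rw [hcBig]; linarith
  constructor
  · calc |((tower P a msq).G k *ᵥ f) x|
        ≤ (C₀ * B4Sect5Proof.latticeConst P.d (δ₀ / 2) + a ^ 2 * cTerm P.d C δ * (1 / ((P.L : ℝ) - 1))) *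
            (Real.exp (-(min (δ₀ / 2) (δ / 4) * (P.eps * D))) * F) := by
          rw [← mul_assoc]; exact value_row_bound P ha hmsq hk1 hkK hkm hC hδ hC₀ hδ₀ hKB hG0 x f hF hD0 hD
      _ ≤ cBig * (Real.exp (-(min (δ₀ / 2) (δ / 4) * (P.eps * D))) * F) := mul_le_mul_of_nonneg_right hv hE
      _ = _ := by rw [mul_assoc]
  · intro μ
    calc |((deriv P 0 P.eps μ * (tower P a msq).G k) *ᵥ f) x|
        ≤ (2 * C₀ * Real.exp δ₀ * B4Sect5Proof.latticeConst P.d (δ₀ / 2) +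
            a ^ 2 * cTerm P.d C δ * (1 / ((P.L : ℝ) - 1))) *
            (Real.exp (-(min (δ₀ / 2) (δ / 4) * (P.eps * D))) * F) := by
          rw [← mul_assoc]; exact deriv_row_bound P ha hmsq hk1 hkK hkm hC hδ hC₀ hδ₀ hKB hG0 μ x f hF hD0 hD
      _ ≤ cBig * (Real.exp (-(min (δ₀ / 2) (δ / 4) * (P.eps * D))) * F) := mul_le_mul_of_nonneg_right hdv hE
      _ = _ := by rw [mul_assoc]

end Uniform

end

end B4Thm110ZeroTorus

end Literature.MathematicalPhysics.QuantumFieldTheory.Balaban1983to89
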